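import Literature.Probability.RandomPlanarGeometry.HexSAWBrickWallStripFugacityWidthOneParityAmplitude
import HarnessLib

/-!
# The spectral gap of the two-wall strip: every singularity of the walk series other than the sextic root is strictly subdominant

The two-fugacity walk series of the one-cell strip is rational (tree, `stripZ₂_one_series`):
`Σ_N C_{1,N}(y,z) x^N = P(x;y,z) / (q(x²)·(1 − yz x⁴)²)` with the cubic `q(t) = (1 − yt)(1 − zt) − yz t³`, whose smallest positive root is
`t₀ = 1/s`, `s = μ₁(y,z)²` the root of the SEXTIC LAW `s(s − y)(s − z) = yz` above `max(y,z)` (tree, `stripMuY₂_one_sq_poly_eq`).  This file locates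
ALL other singularities in the `t = x²` plane, for every `y, z > 0`:
* §1 ★ `sexticFactor_eq`: `q(t) = (1 − s t)·q̃(t)` with the EXPLICIT cofactor `q̃(t) = 1 + (s − y − z)t + (s−y)(s−z)t²` (`(s−y)(s−z) = yz/s`) (over `ℝ` and over `ℂ`), and
  `q̃(1/s) = F(s)/s² > 0` — the dominant root `t₀ = 1/s` is SIMPLE;
* §2 ★★ every REAL root of `q̃` is `> 1/s` (a root `t` gives a second root `σ = 1/t` of the sextic cubic, necessarily below `max(y,z)` by the strict
  monotonicity of `σ(σ−y)(σ−z)` above `max(y,z)`);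
* §3 ★★ every NON-REAL root `t ∈ ℂ` of `q̃` has `|t|² = 1/((s−y)(s−z)) = s/(yz)` (Vieta) `> 1/s²`;
* §4 ★★★ `spectralGap`: every complex zero `t ≠ 1/s` of `q`, and every zero of `1 − yz t²`, satisfies `‖t‖ > 1/s` — in the `x`-plane the poles
  `x = ±1/μ₁` are simple and all other poles lie strictly outside the circle `|x| = 1/μ₁`: the transfer operator of the two-wall strip has a SPECTRAL
  GAP at every pair of fugacities (the structural input for amplitude, variance and CLT asymptotics).

## Sources
Stanley2012EC1 §4.1 Theorem 4.1.1 / §4.7 (rational generating functions: coefficient asymptotics are governed by the poles of smallest modulus);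
BeatonBousquetMelouDeGierDuminilCopinGuttmann2014 §3.2 Proposition 6 (arXiv v5 p. 10: the strip `S_1`, `μ_1(y,z)`); MadrasSlade1993 §1.2, §8.5
(transfer matrices for one-dimensional lattices).  Nothing quoted AS PRINTED; statements are this lineage's.
-/

noncomputable section

open Filter Topology Finset Literature.Probability.LatticeModels Literature.Probability.Percolation SimpleGraph

namespace Literature.Probability.RandomPlanarGeometry.SAW.HexBW

open WidthOneYZ Real

variable {y z : ℝ}

/-! ## §1 The factorisation of the sextic cubic at its dominant root -/

/-- ★ **Factorisation**: with `s = μ₁(y,z)²`, for every real `t`: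
`(1 − yt)(1 − zt) − yz t³ = (1 − s t)·(1 + (s − y − z)t + (s − y)(s − z)t²)` (the sextic law is exactly the compatibility condition).
[cite: BeatonBousquetMelouDeGierDuminilCopinGuttmann2014, §3.2 Proposition 6 (arXiv v5 p. 10; the tree's sextic law); Stanley2012EC1, §4.1 Theorem 4.1.1] -/
theorem sexticFactor_eq (hy : 0 < y) (hz : 0 < z) (t : ℝ) :
    (1 - y * t) * (1 - z * t) - y * z * t ^ 3 =
      (1 - stripMuY₂ 1 y z ^ 2 * t) * (1 + (stripMuY₂ 1 y z ^ 2 - y - z) * t + ((stripMuY₂ 1 y z ^ 2 - y) * (stripMuY₂ 1 y z ^ 2 - z)) * t ^ 2) := by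
  set s := stripMuY₂ 1 y z ^ 2 with hs
  have hlaw := stripMuY₂_one_sq_poly_eq hy hz
  rw [← hs] at hlaw
  linear_combination (t ^ 3) * hlaw

/-- The same factorisation over `ℂ` (complex `t`, real data cast).
[cite: BeatonBousquetMelouDeGierDuminilCopinGuttmann2014, §3.2 Proposition 6 (arXiv v5 p. 10; the tree's sextic law); Stanley2012EC1, §4.1 Theorem 4.1.1] -/
theorem sexticFactor_eq_complex (hy : 0 < y) (hz : 0 < z) (t : ℂ) :
    (1 - (y : ℂ) * t) * (1 - (z : ℂ) * t) - (y : ℂ) * (z : ℂ) * t ^ 3 =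
      (1 - ((stripMuY₂ 1 y z ^ 2 : ℝ) : ℂ) * t) *
        (1 + (((stripMuY₂ 1 y z ^ 2 - y - z : ℝ) : ℂ)) * t + (((stripMuY₂ 1 y z ^ 2 - y) * (stripMuY₂ 1 y z ^ 2 - z) : ℝ) : ℂ) * t ^ 2) := by
  set s := stripMuY₂ 1 y z ^ 2 with hs
  have hlaw := stripMuY₂_one_sq_poly_eq hy hz
  rw [← hs] at hlaw
  have hlawC : (s : ℂ) * ((s : ℂ) - y) * ((s : ℂ) - z) = (y : ℂ) * z := by exact_mod_cast hlaw
  push_cast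
  linear_combination (t ^ 3) * hlawC

/-- **The dominant root is simple**: `q̃(1/s) = F(s)/s²` with `F(s) = (s−y)(s−z) + s(s−z) + s(s−y) > 0`, so `q̃(1/s) > 0`.
[cite: BeatonBousquetMelouDeGierDuminilCopinGuttmann2014, §3.2 Proposition 6 (arXiv v5 p. 10); Stanley2012EC1, §4.1 Theorem 4.1.1] -/
theorem sexticCofactor_at_root_pos (hy : 0 < y) (hz : 0 < z) :
    0 < 1 + (stripMuY₂ 1 y z ^ 2 - y - z) * (1 / stripMuY₂ 1 y z ^ 2) +
      ((stripMuY₂ 1 y z ^ 2 - y) * (stripMuY₂ 1 y z ^ 2 - z)) * (1 / stripMuY₂ 1 y z ^ 2) ^ 2 := by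
  set s := stripMuY₂ 1 y z ^ 2 with hs
  have hlaw := stripMuY₂_one_sq_poly_eq hy hz
  have hmax := max_lt_stripMuY₂_one_sq hy hz
  rw [← hs] at hlaw hmax
  have hsy : y < s := lt_of_le_of_lt (le_max_left _ _) hmax
  have hsz : z < s := lt_of_le_of_lt (le_max_right _ _) hmax
  have hs0 : 0 < s := hy.trans hsy
  -- value `= ((s−y)(s−z) + s(s−z) + s(s−y))/s² = F(s)/s²`
  have hval : 1 + (s - y - z) * (1 / s) + ((s - y) * (s - z)) * (1 / s) ^ 2 =
      ((s - y) * (s - z) + s * (s - z) + s * (s - y)) / s ^ 2 := by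
    field_simp
    ring
  rw [hval]
  exact div_pos (by nlinarith [mul_pos (sub_pos.2 hsy) (sub_pos.2 hsz), mul_pos hs0 (sub_pos.2 hsz)]) (pow_pos hs0 2)

/-! ## §2 Real roots of the cofactor -/

/-- ★★ **Every real root of `q̃` lies strictly beyond `1/s`**: if `1 + (s − y − z)t + (s−y)(s−z)t² = 0` then `1/s < t`.  (Such a `t` is a root of
`q`, hence `t > 0` and `σ = 1/t` solves `σ(σ−y)(σ−z) = yz`; `σ ≠ s` by §1 and `σ ≥ max(y,z)` would force `σ = s` by strict monotonicity, so
`σ < max(y,z) < s`.) [cite: Stanley2012EC1, §4.1 Theorem 4.1.1 (poles of smallest modulus; lane statement); BeatonBousquetMelouDeGierDuminilCopinGuttmann2014, §3.2 Proposition 6 (arXiv v5 p. 10)] -/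
theorem sexticCofactor_real_root_gt (hy : 0 < y) (hz : 0 < z) {t : ℝ}
    (ht : 1 + (stripMuY₂ 1 y z ^ 2 - y - z) * t + ((stripMuY₂ 1 y z ^ 2 - y) * (stripMuY₂ 1 y z ^ 2 - z)) * t ^ 2 = 0) :
    1 / stripMuY₂ 1 y z ^ 2 < t := by
  set s := stripMuY₂ 1 y z ^ 2 with hs
  have hlaw := stripMuY₂_one_sq_poly_eq hy hz
  have hmax := max_lt_stripMuY₂_one_sq hy hz
  rw [← hs] at hlaw hmax
  have hsy : y < s := lt_of_le_of_lt (le_max_left _ _) hmax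
  have hsz : z < s := lt_of_le_of_lt (le_max_right _ _) hmax
  have hs0 : 0 < s := hy.trans hsy
  -- `q(t) = 0`
  have hq : (1 - y * t) * (1 - z * t) - y * z * t ^ 3 = 0 := by
    rw [sexticFactor_eq hy hz t, ← hs, ht, mul_zero]
  -- `t > 0`: for `t ≤ 0` the left side is `≥ 1`
  have ht0 : 0 < t := by
    by_contra h
    have h' : t ≤ 0 := not_lt.1 h
    have : 1 ≤ (1 - y * t) * (1 - z * t) - y * z * t ^ 3 := by
      have a1 : 0 ≤ -t := by linarith
      nlinarith [mul_nonneg hy.le a1, mul_nonneg hz.le a1, mul_nonneg (mul_nonneg hy.le hz.le) (mul_nonneg a1 (sq_nonneg t)),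
        mul_nonneg (mul_nonneg hy.le a1) (mul_nonneg hz.le a1)]
    linarith
  -- `σ = 1/t` solves the sextic
  set σ := 1 / t with hσ
  have hσ0 : 0 < σ := by rw [hσ]; positivity
  have htσ : t = 1 / σ := by rw [hσ, one_div_one_div]
  have hσlaw : σ * (σ - y) * (σ - z) = y * z := by
    have e : σ * (σ - y) * (σ - z) - y * z = σ ^ 3 * ((1 - y * t) * (1 - z * t) - y * z * t ^ 3) := by
      rw [htσ]; field_simp
    rw [hq, mul_zero] at e; linarith
  -- `σ ≠ s` (else `t = 1/s` would be a root of `q̃`, contradicting §1)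
  have hσs : σ ≠ s := by
    intro h
    have hpos := sexticCofactor_at_root_pos hy hz
    rw [← hs] at hpos
    have : t = 1 / s := by rw [htσ, h]
    rw [this] at ht
    linarith
  -- `σ < max y z`
  have hσlt : σ < max y z := by
    by_contra h
    have h' : max y z ≤ σ := not_lt.1 h
    rcases lt_or_gt_of_ne hσs with hlt | hgt
    · have := poly_lt_poly_of_lt h' hlt hy
      rw [hσlaw, hlaw] at this; exact lt_irrefl _ this
    · have := poly_lt_poly_of_lt hmax.le hgt hy
      rw [hσlaw, hlaw] at this; exact lt_irrefl _ this
  have hσs' : σ < s := hσlt.trans hmax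
  rw [htσ]
  exact one_div_lt_one_div_of_lt hσ0 hσs'

/-! ## §3 Non-real roots of the cofactor -/

/-- **Vieta for a pair of conjugate roots**: if `t ∈ ℂ` with `t ≠ conj t` and both are roots of `1 + a t + b t²` (`a, b` real), then `b·t·conj t = 1`.
[cite: Stanley2012EC1, §4.1 Theorem 4.1.1 (lane plumbing)] -/
theorem quad_conj_roots_prod {a b : ℝ} {t : ℂ} (hne : t ≠ (starRingEnd ℂ) t)
    (h1 : 1 + (a : ℂ) * t + (b : ℂ) * t ^ 2 = 0) : (b : ℂ) * (t * (starRingEnd ℂ) t) = 1 := by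
  -- the conjugate is a root too
  have h2 : 1 + (a : ℂ) * (starRingEnd ℂ) t + (b : ℂ) * ((starRingEnd ℂ) t) ^ 2 = 0 := by
    have := congrArg (starRingEnd ℂ) h1
    simpa [map_add, map_mul, map_pow, Complex.conj_ofReal, map_one, map_zero] using this
  -- subtract: `(t − conj t)(a + b(t + conj t)) = 0`
  have hsub : (t - (starRingEnd ℂ) t) * ((a : ℂ) + (b : ℂ) * (t + (starRingEnd ℂ) t)) = 0 := by
    linear_combination h1 - h2
  have hne' : t - (starRingEnd ℂ) t ≠ 0 := sub_ne_zero.2 hne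
  have hlin : (a : ℂ) + (b : ℂ) * (t + (starRingEnd ℂ) t) = 0 := by
    rcases mul_eq_zero.1 hsub with h | h
    · exact absurd h hne'
    · exact h
  linear_combination t * hlin - h1

/-- ★★ **Every non-real root of `q̃` has `|t|² = s/(yz) > 1/s²`**, hence `‖t‖ > 1/s` (`s³ > yz` by the sextic law: `yz = s(s−y)(s−z) < s³`).
[cite: Stanley2012EC1, §4.1 Theorem 4.1.1 (poles of smallest modulus; lane statement); BeatonBousquetMelouDeGierDuminilCopinGuttmann2014, §3.2 Proposition 6 (arXiv v5 p. 10)] -/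
theorem sexticCofactor_nonreal_root_norm (hy : 0 < y) (hz : 0 < z) {t : ℂ} (hne : t ≠ (starRingEnd ℂ) t)
    (ht : 1 + (((stripMuY₂ 1 y z ^ 2 - y - z : ℝ) : ℂ)) * t + (((stripMuY₂ 1 y z ^ 2 - y) * (stripMuY₂ 1 y z ^ 2 - z) : ℝ) : ℂ) * t ^ 2 = 0) :
    Complex.normSq t = stripMuY₂ 1 y z ^ 2 / (y * z) ∧ 1 / stripMuY₂ 1 y z ^ 2 < ‖t‖ := by
  set s := stripMuY₂ 1 y z ^ 2 with hs
  have hlaw := stripMuY₂_one_sq_poly_eq hy hz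
  have hmax := max_lt_stripMuY₂_one_sq hy hz
  rw [← hs] at hlaw hmax
  have hsy : y < s := lt_of_le_of_lt (le_max_left _ _) hmax
  have hsz : z < s := lt_of_le_of_lt (le_max_right _ _) hmax
  have hs0 : 0 < s := hy.trans hsy
  have hyz : 0 < y * z := mul_pos hy hz
  have hprod := quad_conj_roots_prod hne ht
  -- `t * conj t = normSq t`
  rw [Complex.mul_conj] at hprod
  have hb0 : 0 < (s - y) * (s - z) := mul_pos (sub_pos.2 hsy) (sub_pos.2 hsz)
  have hnorm' : (s - y) * (s - z) * Complex.normSq t = 1 := by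
    have h' : (((s - y) * (s - z) : ℝ) : ℂ) * ((Complex.normSq t : ℝ) : ℂ) = ((1 : ℝ) : ℂ) := by
      rw [Complex.ofReal_one]; exact hprod
    exact_mod_cast h'
  have hnorm : Complex.normSq t = s / (y * z) := by
    rw [eq_div_iff hyz.ne']
    -- `normSq t · yz = normSq t · s(s−y)(s−z) = s`
    calc Complex.normSq t * (y * z) = Complex.normSq t * (s * (s - y) * (s - z)) := by rw [hlaw]
      _ = s * ((s - y) * (s - z) * Complex.normSq t) := by ring
      _ = s := by rw [hnorm', mul_one]
  refine ⟨hnorm, ?_⟩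
  -- `‖t‖² = normSq t = 1/((s−y)(s−z)) > 1/s²`
  have hgt : (1 / s) ^ 2 < Complex.normSq t := by
    have e : Complex.normSq t = 1 / ((s - y) * (s - z)) := by
      rw [eq_div_iff hb0.ne']; linarith [hnorm']
    rw [e, div_pow, one_pow, div_lt_div_iff₀ (pow_pos hs0 2) hb0]
    nlinarith [mul_pos hs0 hy, mul_pos hs0 hz, mul_pos hy hz]
  have hn : Complex.normSq t = ‖t‖ ^ 2 := by rw [Complex.normSq_eq_norm_sq]
  rw [hn] at hgt
  exact (pow_lt_pow_iff_left₀ (by positivity) (norm_nonneg t) two_ne_zero).1 hgt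

/-! ## §4 The spectral gap -/

/-- ★★★ **THE SPECTRAL GAP OF THE TWO-WALL STRIP**: for every `y, z > 0`, with `s = μ₁(y,z)²`, every complex zero `t` of the cubic
`q(t) = (1 − yt)(1 − zt) − yz t³` is either the dominant root `t = 1/s` or satisfies `‖t‖ > 1/s`; and every zero of the other denominator factor
`1 − yz t²` satisfies `‖t‖ > 1/s` as well (`‖t‖² = 1/(yz) > 1/s²`).  So all singularities of `Σ_N C_{1,N}(y,z) x^N` other than `x = ±1/μ₁(y,z)`
lie strictly outside the circle `|x| = 1/μ₁`, and `x = ±1/μ₁` are simple poles (§1): the transfer operator of `S₁` has a spectral gap.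
[cite: Stanley2012EC1, §4.1 Theorem 4.1.1 and §4.7 (lane statement); MadrasSlade1993, §8.5 (transfer matrices for one-dimensional lattices); BeatonBousquetMelouDeGierDuminilCopinGuttmann2014, §3.2 Proposition 6 (arXiv v5 p. 10)] -/
theorem spectralGap (hy : 0 < y) (hz : 0 < z) (t : ℂ) :
    ((1 - (y : ℂ) * t) * (1 - (z : ℂ) * t) - (y : ℂ) * (z : ℂ) * t ^ 3 = 0 →
      t = ((1 / stripMuY₂ 1 y z ^ 2 : ℝ) : ℂ) ∨ 1 / stripMuY₂ 1 y z ^ 2 < ‖t‖) ∧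
    (1 - (y : ℂ) * (z : ℂ) * t ^ 2 = 0 → 1 / stripMuY₂ 1 y z ^ 2 < ‖t‖) := by
  set s := stripMuY₂ 1 y z ^ 2 with hs
  have hmax := max_lt_stripMuY₂_one_sq hy hz
  rw [← hs] at hmax
  have hsy : y < s := lt_of_le_of_lt (le_max_left _ _) hmax
  have hsz : z < s := lt_of_le_of_lt (le_max_right _ _) hmax
  have hs0 : 0 < s := hy.trans hsy
  have hyz : 0 < y * z := mul_pos hy hz
  constructor
  · intro hq
    rw [sexticFactor_eq_complex hy hz t, ← hs] at hq
    rcases mul_eq_zero.1 hq with h1 | h2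
    · left
      have hsC : (s : ℂ) ≠ 0 := by exact_mod_cast hs0.ne'
      have : (s : ℂ) * t = 1 := by linear_combination -h1
      rw [Complex.ofReal_div, Complex.ofReal_one]
      field_simp
      linear_combination this
    · right
      by_cases hreal : t = (starRingEnd ℂ) t
      · -- real root: `t = t.re`
        have htre : t = (t.re : ℂ) := by
          rw [eq_comm, ← Complex.conj_eq_iff_re]; exact hreal.symm
        rw [htre] at h2
        have h2' : 1 + (s - y - z) * t.re + ((s - y) * (s - z)) * t.re ^ 2 = 0 := by exact_mod_cast h2
        have hgt := sexticCofactor_real_root_gt hy hz (t := t.re) (by rw [← hs]; exact h2')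
        rw [← hs] at hgt
        rw [htre, Complex.norm_real, Real.norm_eq_abs]
        exact hgt.trans_le (le_abs_self _)
      · exact (sexticCofactor_nonreal_root_norm hy hz hreal (by rw [← hs]; exact h2)).2
  · intro h
    -- `yz t² = 1 ⇒ ‖t‖² = 1/(yz) > 1/s²`
    have h1 : (y : ℂ) * (z : ℂ) * t ^ 2 = 1 := by linear_combination -h
    have hn : y * z * ‖t‖ ^ 2 = 1 := by
      have := congrArg norm h1
      rw [norm_mul, norm_mul, norm_pow, norm_one, Complex.norm_real, Complex.norm_real, Real.norm_eq_abs, Real.norm_eq_abs,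
        abs_of_pos hy, abs_of_pos hz] at this
      exact this
    have hss : y * z < s ^ 2 := by nlinarith
    have hgt : (1 / s) ^ 2 < ‖t‖ ^ 2 := by
      rw [div_pow, one_pow, div_lt_iff₀ (pow_pos hs0 2)]
      nlinarith [norm_nonneg t]
    exact (pow_lt_pow_iff_left₀ (by positivity) (norm_nonneg t) two_ne_zero).1 hgt

end Literature.Probability.RandomPlanarGeometry.SAW.HexBW
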